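import Summits.RiemannHypothesis.RiemannHypothesis.Theorems.MotivicDoorFfSparseThreshold
import Mathlib.NumberTheory.SiegelsLemma

/-!
# Motivic door, function-field side (C)(i), part 8b: the WEIGHTED COUNT BOUND — light lag sets are blind
(pub-rhdoor seat ff-1.  HONEST FRAMING: lottery ticket at the motivic door; RH probability negligible; consolation
prizes are real: a new semi-local Weil-positivity theorem, or a located gap in the Connes–Consani programme, plus the
ff-door theorem.  No claim about `ζ`; "RH(q,h)" is `|α| = √q` for the complex roots of ONE integer polynomial `h`.)

Parts 7b/7c/8a gave: inside `[0, g]` exactly the supersets of `{1, …, g}` decide; a decider contains a non-zero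
multiple of every `N ≤ g` dividing `2g`; every progression `{N, …, gN}` decides.  Here a third, COUNTING obstruction
for lags ABOVE `g`, PROVED [folklore]:

* §1 AFFINE TRACES (`powerSum_fibreShift_family_affine`): along the fibre-shift family `f_a = h + fibreShift[q,g,k,a]`
  of part 5b (`k + 1 ≤ g`; the `g - k` free top coefficients `c_{2g-i}`, `k < i ≤ g`, moved by `a_i`, the lower
  ones by the FE) every power sum `s_n(f_a)` with `n ≤ 2k + 1` is an AFFINE function of `a ∈ ℤ^{g-k}` with integer
  coefficients: in Newton's recursion `s_n = -n c_{2g-n} - Σ_{i+j=n} c_{2g-i} s_j` no product has two non-constant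
  factors (`i ≤ k ⇒ c_{2g-i}(f_a) = c_{2g-i}(h)`; `i > k ⇒ j ≤ k ⇒ s_j(f_a) = s_j(h)`).
* §2 LIGHT LAG SETS HAVE INFINITE FIBRES (`lightFibre_infinite`): if `F ⊆ [0, 2k+1]` is finite with
  `#{n ∈ F : n > k} < g - k`, then through EVERY honest datum of dimension `g` (`q ≥ 1`) pass infinitely many honest
  data of dimension `g` with the same traces `K(n)`, `n ∈ F` — the trace constraints are `#{n ∈ F : n > k}`
  homogeneous integer LINEAR equations in `g - k` unknowns (Siegel's lemma, Mathlib), void for `n ≤ k`.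
* §3 DOOR READING (`traceReader_light_fakes_infinite`, `traceReader_not_decides_of_light`,
  `traceReader_not_decides_of_weightedCard_lt`): such a reader accepting one honest datum of dimension `g` accepts
  infinitely many honest RH-false ones with the same traces; NO such reader decides RH at dimension `g`.  WEIGHTED
  COUNT: `#(F ∖ {0}) + ⌊max F / 2⌋ < g ⇒ F` does not decide — a lag `n` costs `⌊n/2⌋`, lags above `g` are not free.
  Example: `g = 6`, `F = {4, 6}` passes part 7c's divisibility test (non-zero multiples of `1, 2, 3, 4, 6`) and is
  blind by weight (`2 + 3 < 6`).

Nothing here is, or implies, a statement about `ζ`.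
-/

set_option linter.dupNamespace false

noncomputable section

open Polynomial Finset Matrix

open Summit.RiemannHypothesis.RiemannHypothesis.Theorems.PfPersistence.FfAngleTwin
open Summit.RiemannHypothesis.RiemannHypothesis.Theorems.MotivicDoor.FfLatticeFloor

namespace Summit.RiemannHypothesis.RiemannHypothesis.Theorems.MotivicDoor.FunctionField

/-! The FE-symmetric FIBRE SHIFT of part 5b (file-local notation for the explicit sum, as in parts 5b/7a). -/
local notation "fibreShift[" q ", " g ", " M ", " a "]" =>
  ((∑ k ∈ Finset.Ioo M g, C (a k) * (X ^ (2 * g - k) + C ((q : ℤ) ^ (g - k)) * X ^ k)) + C (a g) * X ^ g : ℤ[X])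

/-! ## 1. Affine traces along the fibre-shift family -/

/-- Sums of affine forms are affine (bookkeeping). -/
private theorem affine_sum_aux (s : Finset ℕ) {ι : Type*} (P : Finset ι) (c : ι → ℤ) (l : ι → ℕ → ℤ)
    (a : ℕ → ℤ) :
    ∑ p ∈ P, (c p + ∑ t ∈ s, l p t * a t) = (∑ p ∈ P, c p) + ∑ t ∈ s, (∑ p ∈ P, l p t) * a t := by
  rw [sum_add_distrib, sum_comm]
  congr 1
  exact sum_congr rfl fun t _ => by rw [sum_mul]

/-- TOP COEFFICIENTS along the family `f_a = h + fibreShift[q,g,k,a]` (`k + 1 ≤ g`): `c_{2g-i}(f_a)`, `i ≤ g`, is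
affine in `a` — `c_{2g-i}(h)` for `i ≤ k`, `c_{2g-i}(h) + a_i` for `k < i ≤ g` (part 5b). [folklore] -/
theorem coeff_fibreShift_family_top_affine {q : ℕ} {g k : ℕ} (hk : k + 1 ≤ g) {h : ℤ[X]} (hh : h.Monic)
    (hdeg : h.natDegree = 2 * g)
    (hFE : ∀ i j, i + j = 2 * g → (q : ℤ) ^ g * h.coeff j = (q : ℤ) ^ i * h.coeff i) {i : ℕ} (hi : i ≤ g) :
    ∃ c : ℤ, ∃ l : ℕ → ℤ, ∀ a : ℕ → ℤ,
      (h + fibreShift[q, g, k, a]).coeff (2 * g - i) = c + ∑ t ∈ Ioc k g, l t * a t := by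
  by_cases hik : i ≤ k
  · refine ⟨h.coeff (2 * g - i), fun _ => 0, fun a => ?_⟩
    rw [coeff_add, coeff_fibreShift_eq_zero q hk a (by omega)]
    simp
  · have hi' : i ∈ Ioc k g := mem_Ioc.2 ⟨by omega, hi⟩
    refine ⟨h.coeff (2 * g - i), fun t => if t = i then 1 else 0, fun a => ?_⟩
    rw [(fibreShift_honest hk hh hdeg hFE a).2.2.2.2 i (by omega) hi,
      sum_eq_single_of_mem i hi' (fun t _ hti => by simp [hti])]
    simp

/-- ALL COEFFICIENTS along the family are affine in `a` (`q ≥ 1`): for `g < i ≤ 2g` the FE of `f_a` gives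
`c_{2g-i} = q^{i-g} c_i` and `c_i` is a top coefficient. [folklore] -/
theorem coeff_fibreShift_family_affine {q : ℕ} (hq : 0 < q) {g k : ℕ} (hk : k + 1 ≤ g) {h : ℤ[X]}
    (hh : h.Monic) (hdeg : h.natDegree = 2 * g)
    (hFE : ∀ i j, i + j = 2 * g → (q : ℤ) ^ g * h.coeff j = (q : ℤ) ^ i * h.coeff i) {i : ℕ} (hi : i ≤ 2 * g) :
    ∃ c : ℤ, ∃ l : ℕ → ℤ, ∀ a : ℕ → ℤ,
      (h + fibreShift[q, g, k, a]).coeff (2 * g - i) = c + ∑ t ∈ Ioc k g, l t * a t := by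
  by_cases hig : i ≤ g
  · exact coeff_fibreShift_family_top_affine hk hh hdeg hFE hig
  · obtain ⟨c, l, hcl⟩ := coeff_fibreShift_family_top_affine (q := q) (k := k) hk hh hdeg hFE (i := 2 * g - i)
      (by omega)
    have hq0 : (q : ℤ) ≠ 0 := by exact_mod_cast hq.ne'
    have hqi : (q : ℤ) ^ i = (q : ℤ) ^ g * (q : ℤ) ^ (i - g) := by rw [← pow_add]; congr 1; omega
    refine ⟨(q : ℤ) ^ (i - g) * c, fun t => (q : ℤ) ^ (i - g) * l t, fun a => ?_⟩
    obtain ⟨-, -, hFEa, -, -⟩ := fibreShift_honest hk hh hdeg hFE a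
    have e := hFEa i (2 * g - i) (by omega)
    have hcla := hcl a
    rw [show 2 * g - (2 * g - i) = i by omega] at hcla
    have e' : (h + fibreShift[q, g, k, a]).coeff (2 * g - i) = (q : ℤ) ^ (i - g) * (c + ∑ t ∈ Ioc k g, l t * a t) :=
      mul_left_cancel₀ (pow_ne_zero g hq0) (by rw [e, hcla, hqi, mul_assoc])
    rw [e']
    simp only [mul_add, mul_sum, mul_assoc]

/-- AFFINE TRACES BELOW `2k + 1`: along the family `f_a = h + fibreShift[q,g,k,a]` (`k + 1 ≤ g`, `q ≥ 1`) every power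
sum `s_n(f_a)`, `n ≤ 2k + 1`, is an AFFINE function of `a` with integer coefficients.  (Newton: in
`s_n = -n c_{2g-n} - Σ_{i+j=n, i,j≥1} c_{2g-i} s_j` a product never has two non-constant factors —
`i ≤ k ⇒ c_{2g-i}(f_a) = c_{2g-i}(h)`, `i > k ⇒ j ≤ k ⇒ s_j(f_a) = s_j(h)` by the unchanged window `T_k`.) [folklore] -/
theorem powerSum_fibreShift_family_affine {q : ℕ} (hq : 0 < q) {g k : ℕ} (hk : k + 1 ≤ g) {h : ℤ[X]}
    (hh : h.Monic) (hdeg : h.natDegree = 2 * g)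
    (hFE : ∀ i j, i + j = 2 * g → (q : ℤ) ^ g * h.coeff j = (q : ℤ) ^ i * h.coeff i) :
    ∀ n, n ≤ 2 * k + 1 → ∃ c : ℤ, ∃ l : ℕ → ℤ, ∀ a : ℕ → ℤ,
      powerSum (frobRoots (h + fibreShift[q, g, k, a])) n = ((c + ∑ t ∈ Ioc k g, l t * a t : ℤ) : ℂ) := by
  have hq' : (0 : ℝ) < q := by exact_mod_cast hq
  -- integer power sums of every member of the family, and of `h`
  have hZex : ∀ a : ℕ → ℤ, ∃ z : ℕ → ℤ, ∀ n, powerSum (frobRoots (h + fibreShift[q, g, k, a])) n = (z n : ℂ) :=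
    fun a => exists_int_powerSum_frobRoots (fibreShift_honest hk hh hdeg hFE a).1
  choose Z hZ using hZex
  obtain ⟨z, hz⟩ := exists_int_powerSum_frobRoots hh
  have hlow : ∀ a j, j ≤ k → Z a j = z j := by
    intro a j hj
    have e := powerSum_eq_of_ffWindowForm_eq hq' (fibreShift_honest hk hh hdeg hFE a).2.2.2.1 hj
    rw [hZ a j, hz j] at e
    exact_mod_cast e
  suffices H : ∀ n, n ≤ 2 * k + 1 → ∃ c : ℤ, ∃ l : ℕ → ℤ, ∀ a : ℕ → ℤ, Z a n = c + ∑ t ∈ Ioc k g, l t * a t by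
    intro n hn
    obtain ⟨c, l, hcl⟩ := H n hn
    exact ⟨c, l, fun a => by rw [hZ a n, hcl a]⟩
  intro n
  induction n using Nat.strong_induction_on with
  | _ n ih =>
    intro hn
    rcases Nat.eq_zero_or_pos n with rfl | hn1
    · refine ⟨2 * g, fun _ => 0, fun a => ?_⟩
      obtain ⟨hmon, hdega, -⟩ := fibreShift_honest hk hh hdeg hFE a
      have e := hZ a 0
      rw [powerSum_zero, card_frobRoots hmon, hdega] at e
      simp only [zero_mul, sum_const_zero, add_zero]
      exact_mod_cast e.symm
    -- every Newton term `c_{2g-i}(f_a) · Z_a(j)` (`i + j = n`, `i, j ≥ 1`) is affine in `a`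
    have hterm : ∀ p : ℕ × ℕ, ∃ c : ℤ, ∃ l : ℕ → ℤ, p.1 + p.2 = n → 0 < p.1 → 0 < p.2 → ∀ a : ℕ → ℤ,
        (h + fibreShift[q, g, k, a]).coeff (2 * g - p.1) * Z a p.2 = c + ∑ t ∈ Ioc k g, l t * a t := by
      rintro ⟨i, j⟩
      by_cases hij : i + j = n ∧ 0 < i ∧ 0 < j
      · obtain ⟨hijn, hi0, hj0⟩ := hij
        by_cases hik : i ≤ k
        · obtain ⟨c, l, hcl⟩ := ih j (by omega) (by omega)
          refine ⟨h.coeff (2 * g - i) * c, fun t => h.coeff (2 * g - i) * l t, fun _ _ _ a => ?_⟩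
          simp only
          rw [coeff_add, coeff_fibreShift_eq_zero q hk a (by omega), add_zero, hcl a]
          simp only [mul_add, mul_sum, mul_assoc]
        · obtain ⟨c, l, hcl⟩ := coeff_fibreShift_family_affine hq hk hh hdeg hFE (i := i) (by omega)
          refine ⟨c * z j, fun t => l t * z j, fun _ _ _ a => ?_⟩
          simp only
          rw [hcl a, hlow a j (by omega)]
          simp only [add_mul, sum_mul, mul_right_comm]
      · exact ⟨0, fun _ => 0, fun h1 h2 h3 => absurd ⟨h1, h2, h3⟩ hij⟩
    choose c l hcl using hterm
    obtain ⟨c₀, l₀, hcl₀⟩ := coeff_fibreShift_family_affine hq hk hh hdeg hFE (i := n) (by omega)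
    set P := (antidiagonal n).filter (fun a : ℕ × ℕ => 0 < a.1 ∧ 0 < a.2) with hP
    refine ⟨-((n : ℤ) * c₀) - ∑ p ∈ P, c p, fun t => -((n : ℤ) * l₀ t) - ∑ p ∈ P, l p t, fun a => ?_⟩
    obtain ⟨hmon, hdega, -⟩ := fibreShift_honest hk hh hdeg hFE a
    have hnewton := int_powerSum_newton hmon (hZ a) hn1 (by rw [hdega]; omega)
    rw [hdega] at hnewton
    have hsum : ∑ p ∈ P, (h + fibreShift[q, g, k, a]).coeff (2 * g - p.1) * Z a p.2
        = ∑ p ∈ P, (c p + ∑ t ∈ Ioc k g, l p t * a t) := by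
      refine sum_congr rfl fun p hp => ?_
      rw [hP, mem_filter, HasAntidiagonal.mem_antidiagonal] at hp
      exact hcl p hp.1 hp.2.1 hp.2.2 a
    rw [hnewton, hcl₀ a, hsum, affine_sum_aux]
    simp only [mul_add, mul_sum, sub_mul, neg_mul, sum_sub_distrib, sum_neg_distrib, mul_assoc]
    ring

/-! ## 2. Light lag sets have infinite fibres -/

/-- LIGHT LAG SETS HAVE INFINITE FIBRES: `q ≥ 1`, `k + 1 ≤ g`, `F` a finite set of lags `≤ 2k + 1` with fewer than
`g - k` members above `k`.  Through every honest datum `h` of dimension `g` pass INFINITELY MANY honest data of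
dimension `g` with the same traces `K(n)`, `n ∈ F` — inside the family `h + fibreShift[q,g,k,a]`: the constraints
`s_n(f_a) = s_n(h)` are void for `n ≤ k` (window `T_k` unchanged) and `#{n ∈ F : n > k} < g - k` homogeneous integer
LINEAR equations in the `g - k` unknowns `a` for `k < n ≤ 2k+1` (§1), solved by Siegel's lemma. [folklore] -/
theorem lightFibre_infinite {q : ℕ} (hq : 0 < q) {g k : ℕ} (hk : k + 1 ≤ g) {F : Finset ℕ}
    (hF : ∀ n ∈ F, n ≤ 2 * k + 1) (hcard : (F.filter (fun n => k < n)).card + k < g) {h : ℤ[X]} (hh : h.Monic)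
    (hdeg : h.natDegree = 2 * g)
    (hFE : ∀ i j, i + j = 2 * g → (q : ℤ) ^ g * h.coeff j = (q : ℤ) ^ i * h.coeff i) :
    {f : ℤ[X] | f.Monic ∧ f.natDegree = 2 * g ∧
      (∀ i j, i + j = 2 * g → (q : ℤ) ^ g * f.coeff j = (q : ℤ) ^ i * f.coeff i) ∧
      ∀ n ∈ F, weilWindowTower (q : ℝ) f n 0 (Fin.last n) = weilWindowTower (q : ℝ) h n 0 (Fin.last n)}.Infinite := by
  classical
  have hq' : (0 : ℝ) < q := by exact_mod_cast hq
  -- affine forms of the traces `s_n(f_a)`, `n ≤ 2k+1`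
  have haff := powerSum_fibreShift_family_affine hq hk hh hdeg hFE
  have hex : ∀ n : ℕ, ∃ c : ℤ, ∃ l : ℕ → ℤ, n ≤ 2 * k + 1 → ∀ a : ℕ → ℤ,
      powerSum (frobRoots (h + fibreShift[q, g, k, a])) n = ((c + ∑ t ∈ Ioc k g, l t * a t : ℤ) : ℂ) := by
    intro n
    by_cases hn : n ≤ 2 * k + 1
    · obtain ⟨c, l, hcl⟩ := haff n hn
      exact ⟨c, l, fun _ => hcl⟩
    · exact ⟨0, fun _ => 0, fun h' => absurd h' hn⟩
  choose c l hcl using hex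
  -- `a = 0` is `h` itself, so `c n = s_n(h)`
  have hshift0 : (fibreShift[q, g, k, fun _ => (0 : ℤ)]) = 0 := by simp
  have hc : ∀ n, n ≤ 2 * k + 1 → powerSum (frobRoots h) n = (c n : ℂ) := by
    intro n hn
    have e := hcl n hn (fun _ => 0)
    rw [hshift0, add_zero] at e
    rw [e]
    simp
  -- a non-zero integer direction `τ` killing the linear parts `l n`, `n ∈ F`, `n > k` (Siegel; trivial if none)
  set F' := F.filter (fun n => k < n) with hF'
  obtain ⟨τ, hτ0, hτ⟩ : ∃ τ : Ioc k g → ℤ, τ ≠ 0 ∧ ∀ n ∈ F', ∑ t : Ioc k g, l n t * τ t = 0 := by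
    by_cases hF'e : F' = ∅
    · refine ⟨fun _ => 1, fun h0 => ?_, fun n hn => ?_⟩
      · exact one_ne_zero (congrFun h0 ⟨g, mem_Ioc.2 ⟨by omega, le_rfl⟩⟩)
      · rw [hF'e] at hn
        exact absurd hn (Finset.notMem_empty n)
    · have hm : 0 < Fintype.card F' := by
        rw [Fintype.card_coe]
        exact card_pos.2 (nonempty_iff_ne_empty.2 hF'e)
      have hn : Fintype.card F' < Fintype.card (Ioc k g) := by
        rw [Fintype.card_coe, Fintype.card_coe, Nat.card_Ioc]
        omega
      obtain ⟨τ, hτ0, hAτ, -⟩ :=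
        Int.Matrix.exists_ne_zero_int_vec_norm_le (Matrix.of fun (n : F') (t : Ioc k g) => l n t) hn hm
      refine ⟨τ, hτ0, fun n hn' => ?_⟩
      have e := congrFun hAτ ⟨n, hn'⟩
      simpa [Matrix.mulVec, dotProduct] using e
  obtain ⟨t₀, ht₀⟩ : ∃ t₀, τ t₀ ≠ 0 := by
    by_contra hall
    push Not at hall
    exact hτ0 (funext hall)
  -- the one-parameter sub-family `m ↦ f_{m τ}`
  let A : ℤ → ℕ → ℤ := fun m t => if ht : t ∈ Ioc k g then m * τ ⟨t, ht⟩ else 0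
  have hsumA : ∀ m n, n ∈ F' → ∑ t ∈ Ioc k g, l n t * A m t = 0 := by
    intro m n hn
    rw [← sum_coe_sort]
    have e : ∑ t : Ioc k g, l n t * A m t = m * ∑ t : Ioc k g, l n t * τ t := by
      rw [mul_sum]
      refine sum_congr rfl fun t _ => ?_
      simp only [A, dif_pos t.2, Subtype.coe_eta]
      ring
    rw [e, hτ n hn, mul_zero]
  have hmem : ∀ m : ℤ, (h + fibreShift[q, g, k, A m]) ∈ {f : ℤ[X] | f.Monic ∧ f.natDegree = 2 * g ∧
      (∀ i j, i + j = 2 * g → (q : ℤ) ^ g * f.coeff j = (q : ℤ) ^ i * f.coeff i) ∧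
      ∀ n ∈ F, weilWindowTower (q : ℝ) f n 0 (Fin.last n) = weilWindowTower (q : ℝ) h n 0 (Fin.last n)} := by
    intro m
    obtain ⟨hmon, hdega, hFEa, hwin, -⟩ := fibreShift_honest hk hh hdeg hFE (A m)
    refine ⟨hmon, hdega, hFEa, fun n hn => (corner_eq_iff_powerSum_eq hq' _ _ n).2 ?_⟩
    by_cases hnk : n ≤ k
    · exact powerSum_eq_of_ffWindowForm_eq hq' hwin hnk
    · rw [hcl n (hF n hn) (A m), hsumA m n (mem_filter.2 ⟨hn, by omega⟩), add_zero, hc n (hF n hn)]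
  have hinj : Function.Injective fun m : ℤ => h + fibreShift[q, g, k, A m] := by
    intro m m' hmm'
    have e := congrArg (fun f : ℤ[X] => f.coeff (2 * g - t₀)) hmm'
    simp only at e
    rw [(fibreShift_honest hk hh hdeg hFE (A m)).2.2.2.2 t₀ (mem_Ioc.1 t₀.2).1 (mem_Ioc.1 t₀.2).2,
      (fibreShift_honest hk hh hdeg hFE (A m')).2.2.2.2 t₀ (mem_Ioc.1 t₀.2).1 (mem_Ioc.1 t₀.2).2,
      add_right_inj] at e
    simp only [A, dif_pos t₀.2, Subtype.coe_eta] at e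
    exact mul_right_cancel₀ ht₀ e
  exact Set.infinite_of_injective_forall_mem hinj hmem

/-! ## 3. Door reading: light lag sets are matched by honest fakes and never decide -/

/-- FF-DOOR (i).G, WEIGHTED COUNT — MATCHED FORM: a trace reader reading a finite lag set `F ⊆ [0, 2k+1]` with fewer
than `g - k` lags above `k` (`k + 1 ≤ g`, `q ≥ 1`) that accepts ONE honest datum `h` of dimension `g` accepts
INFINITELY MANY honest RH-false data of dimension `g` with the very same traces on `F`. [folklore] -/
theorem traceReader_light_fakes_infinite {Φ : Tower → Prop} {q : ℕ} (hq : 0 < q) {g k : ℕ} (hk : k + 1 ≤ g)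
    {F : Finset ℕ} (hF : ∀ n ∈ F, n ≤ 2 * k + 1) (hcard : (F.filter (fun n => k < n)).card + k < g)
    (hloc : ∀ T T' : Tower, (∀ n ∈ (F : Set ℕ), T n 0 (Fin.last n) = T' n 0 (Fin.last n)) → Φ T → Φ T')
    {h : ℤ[X]} (hh : h.Monic) (hdeg : h.natDegree = 2 * g)
    (hFE : ∀ i j, i + j = 2 * g → (q : ℤ) ^ g * h.coeff j = (q : ℤ) ^ i * h.coeff i)
    (hΦ : Φ (weilWindowTower (q : ℝ) h)) :
    {f : ℤ[X] | f.Monic ∧ f.natDegree = 2 * g ∧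
      (∀ i j, i + j = 2 * g → (q : ℤ) ^ g * f.coeff j = (q : ℤ) ^ i * f.coeff i) ∧
      (¬ ∀ α ∈ frobRoots f, ‖α‖ = Real.sqrt q) ∧
      (∀ n ∈ F, weilWindowTower (q : ℝ) f n 0 (Fin.last n) = weilWindowTower (q : ℝ) h n 0 (Fin.last n)) ∧
      Φ (weilWindowTower (q : ℝ) f)}.Infinite := by
  refine Set.Infinite.mono ?_ ((lightFibre_infinite hq hk hF hcard hh hdeg hFE).sdiff (setOf_ffRH_finite q g))
  rintro f ⟨⟨hf, hdegf, hFEf, htr⟩, hnot⟩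
  exact ⟨hf, hdegf, hFEf, fun hR => hnot ⟨hf, hdegf, hR⟩, htr, hloc _ _ (fun n hn => (htr n hn).symm) hΦ⟩

/-- … in `∃`-form: such a reader accepting an honest datum of dimension `g` accepts an honest RH-FALSE datum of
dimension `g` with the same traces. [folklore] -/
theorem traceReader_light_matched_by_rhFalse {Φ : Tower → Prop} {q : ℕ} (hq : 0 < q) {g k : ℕ} (hk : k + 1 ≤ g)
    {F : Finset ℕ} (hF : ∀ n ∈ F, n ≤ 2 * k + 1) (hcard : (F.filter (fun n => k < n)).card + k < g)
    (hloc : ∀ T T' : Tower, (∀ n ∈ (F : Set ℕ), T n 0 (Fin.last n) = T' n 0 (Fin.last n)) → Φ T → Φ T')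
    {h : ℤ[X]} (hh : h.Monic) (hdeg : h.natDegree = 2 * g)
    (hFE : ∀ i j, i + j = 2 * g → (q : ℤ) ^ g * h.coeff j = (q : ℤ) ^ i * h.coeff i)
    (hΦ : Φ (weilWindowTower (q : ℝ) h)) :
    ∃ f : ℤ[X], f.Monic ∧ f.natDegree = 2 * g ∧
      (∀ i j, i + j = 2 * g → (q : ℤ) ^ g * f.coeff j = (q : ℤ) ^ i * f.coeff i) ∧
      (¬ ∀ α ∈ frobRoots f, ‖α‖ = Real.sqrt q) ∧
      (∀ n ∈ F, weilWindowTower (q : ℝ) f n 0 (Fin.last n) = weilWindowTower (q : ℝ) h n 0 (Fin.last n)) ∧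
      Φ (weilWindowTower (q : ℝ) f) := by
  obtain ⟨f, hf⟩ := (traceReader_light_fakes_infinite hq hk hF hcard hloc hh hdeg hFE hΦ).nonempty
  exact ⟨f, hf⟩

/-- FF-DOOR (i).G, LIGHT LAG SETS NEVER DECIDE: for `q ≥ 1`, `k + 1 ≤ g` and a finite lag set `F ⊆ [0, 2k + 1]` with
`#{n ∈ F : n > k} < g - k`, NO `F`-trace-local reader decides RH on the honest data of dimension `g` (§2 through the
RH-true datum `x^{2g} + q^g`). [folklore] -/
theorem traceReader_not_decides_of_light {q : ℕ} (hq : 0 < q) {g k : ℕ} (hk : k + 1 ≤ g) {F : Finset ℕ}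
    (hF : ∀ n ∈ F, n ≤ 2 * k + 1) (hcard : (F.filter (fun n => k < n)).card + k < g) :
    ¬ ∃ Φ : Tower → Prop,
      (∀ T T' : Tower, (∀ n ∈ (F : Set ℕ), T n 0 (Fin.last n) = T' n 0 (Fin.last n)) → Φ T → Φ T') ∧
      ∀ h : ℤ[X], h.Monic → h.natDegree = 2 * g →
        (∀ i j, i + j = 2 * g → (q : ℤ) ^ g * h.coeff j = (q : ℤ) ^ i * h.coeff i) →
        (Φ (weilWindowTower (q : ℝ) h) ↔ ∀ α ∈ frobRoots h, ‖α‖ = Real.sqrt q) := by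
  rintro ⟨Φ, hloc, hdec⟩
  have hg : 1 ≤ g := by omega
  obtain ⟨hmon, hdeg, hFE⟩ := fe_X_pow_add_C q hg
  have hΦ : Φ (weilWindowTower (q : ℝ) (X ^ (2 * g) + C ((q : ℤ) ^ g))) :=
    (hdec _ hmon hdeg hFE).2 (ffRH_X_pow_add_C q hg)
  obtain ⟨f, hf, hdegf, hFEf, hR, -, hΦf⟩ :=
    traceReader_light_matched_by_rhFalse hq hk hF hcard hloc hmon hdeg hFE hΦ
  exact hR ((hdec f hf hdegf hFEf).1 hΦf)

/-- FF-DOOR (i).G, THE WEIGHTED COUNT BOUND: a finite lag set `F` with `#(F ∖ {0}) + ⌊max F / 2⌋ < g` supports NO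
trace-local reader deciding RH on the honest data of dimension `g` (`q ≥ 1`; `k = ⌊max F / 2⌋` in
`traceReader_not_decides_of_light`).  A lag `n` costs `⌊n/2⌋` of the budget `g`: lags above `g` are not free.
Example: `g = 6`, `F = {4, 6}` passes the divisibility test of part 7c and is blind (`2 + 3 < 6`). [folklore] -/
theorem traceReader_not_decides_of_weightedCard_lt {q : ℕ} (hq : 0 < q) {g : ℕ} {F : Finset ℕ}
    (hcard : (F.filter (fun n => 0 < n)).card + F.sup id / 2 < g) :
    ¬ ∃ Φ : Tower → Prop,
      (∀ T T' : Tower, (∀ n ∈ (F : Set ℕ), T n 0 (Fin.last n) = T' n 0 (Fin.last n)) → Φ T → Φ T') ∧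
      ∀ h : ℤ[X], h.Monic → h.natDegree = 2 * g →
        (∀ i j, i + j = 2 * g → (q : ℤ) ^ g * h.coeff j = (q : ℤ) ^ i * h.coeff i) →
        (Φ (weilWindowTower (q : ℝ) h) ↔ ∀ α ∈ frobRoots h, ‖α‖ = Real.sqrt q) := by
  have hsub : F.filter (fun n => F.sup id / 2 < n) ⊆ F.filter (fun n => 0 < n) := fun n hn => by
    rw [mem_filter] at hn ⊢
    exact ⟨hn.1, lt_of_le_of_lt (Nat.zero_le _) hn.2⟩
  have hle := card_le_card hsub
  refine traceReader_not_decides_of_light hq (k := F.sup id / 2) (by omega) (fun n hn => ?_) (by omega)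
  have : n ≤ F.sup id := le_sup (f := id) hn
  omega

end Summit.RiemannHypothesis.RiemannHypothesis.Theorems.MotivicDoor.FunctionField

end
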